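import Literature.Analysis.FluidPDE.DissipativeMVEuler
import Summits.AtomisticToContinuum.HydrodynamicLimit.Theses.JParityClosure
import HarnessLib

/-!
# JParityClosure / ParityInBand — helper: the BF18 equation-of-state hypotheses for a monatomic
# gas with excess free energy

Step (iv) of `Summit.AtomisticToContinuum.HydrodynamicLimit.Theses.JParityClosure.ParityInBand`
runs `Literature.Analysis.FluidPDE.CompressibleEuler.brezinaFeireisl2018_thm_3_3` for (a band
modification of) the hard-sphere law, which is `EulerEOS.monatomicExcess χ f` with
`χ ρ = hsCompressibility (ρσ³)`, `f ρ = hsExcessFreeEnergy (ρσ³)` (`DissipativeMVEuler.lean`). The fact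
asks of the equation of state: Gibbs' relation (`IsGibbs`), thermodynamic stability, `C²` constitutive
functions on the open quadrant, `e > 0`, a genuine temperature inversion, and the pressure growth
bound (3.1). This file discharges all of them for `monatomicExcess χ f` under the natural hypotheses
on `χ, f : ℝ → ℝ` on `(0, ∞)`: smoothness, the virial relation `χ ρ = 1 + ρ f'(ρ)` (Gibbs), the
monotonicity `(ρ χ)' > 0` (stability) and boundedness of `χ` (growth).
-/

namespace Summit.AtomisticToContinuum.HydrodynamicLimit.Theorems

open Set Literature.Analysis.FluidPDE Literature.Analysis.FluidPDE.CompressibleEuler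

variable (χ f : ℝ → ℝ)

/-- The internal energy `e = 3ϑ/2` of the monatomic gas is positive at positive temperature.
[folklore] -/
theorem monatomicExcess_e_pos (ρ : ℝ) {ϑ : ℝ} (hϑ : 0 < ϑ) :
    0 < (EulerEOS.monatomicExcess χ f).e ρ ϑ := by
  simp only [EulerEOS.monatomicExcess]
  positivity

/-- The temperature inversion `ϑ(ρ,E) = 2E/(3ρ)` of the monatomic gas is a genuine inverse of
`ϑ ↦ ρ e(ρ,ϑ) = 3ρϑ/2` on the open quadrant. [folklore] -/
theorem monatomicExcess_temperature {ρ E : ℝ} (hρ : 0 < ρ) (hE : 0 < E) :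
    0 < (EulerEOS.monatomicExcess χ f).temperature ρ E ∧
      ρ * (EulerEOS.monatomicExcess χ f).e ρ ((EulerEOS.monatomicExcess χ f).temperature ρ E) = E := by
  simp only [EulerEOS.monatomicExcess]
  refine ⟨by positivity, ?_⟩
  field_simp

/-- The internal energy `e(ρ,ϑ) = 3ϑ/2` is smooth (jointly, everywhere). [folklore] -/
theorem monatomicExcess_contDiffOn_e {n : WithTop ℕ∞} (s : Set (ℝ × ℝ)) :
    ContDiffOn ℝ n (Function.uncurry (EulerEOS.monatomicExcess χ f).e) s := by
  have : Function.uncurry (EulerEOS.monatomicExcess χ f).e = fun q : ℝ × ℝ => 3 / 2 * q.2 := by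
    funext q; rfl
  rw [this]
  exact (contDiff_const.mul contDiff_snd).contDiffOn

/-- The pressure `p(ρ,ϑ) = ρ ϑ χ(ρ)` is `Cⁿ` on the open quadrant as soon as `χ` is `Cⁿ` on `(0,∞)`.
[folklore] -/
theorem monatomicExcess_contDiffOn_p {n : WithTop ℕ∞} (hχ : ContDiffOn ℝ n χ (Ioi 0)) :
    ContDiffOn ℝ n (Function.uncurry (EulerEOS.monatomicExcess χ f).p) (Ioi 0 ×ˢ Ioi 0) := by
  have : Function.uncurry (EulerEOS.monatomicExcess χ f).p = fun q : ℝ × ℝ => q.1 * q.2 * χ q.1 := by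
    funext q; rfl
  rw [this]
  refine (contDiffOn_fst.mul contDiffOn_snd).mul (hχ.comp contDiffOn_fst ?_)
  intro q hq
  exact hq.1

/-- The entropy `s(ρ,ϑ) = 3/2 log ϑ - log ρ - f(ρ)` is `Cⁿ` on the open quadrant as soon as `f` is
`Cⁿ` on `(0,∞)`. [folklore] -/
theorem monatomicExcess_contDiffOn_s {n : WithTop ℕ∞} (hf : ContDiffOn ℝ n f (Ioi 0)) :
    ContDiffOn ℝ n (Function.uncurry (EulerEOS.monatomicExcess χ f).s) (Ioi 0 ×ˢ Ioi 0) := by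
  have : Function.uncurry (EulerEOS.monatomicExcess χ f).s =
      fun q : ℝ × ℝ => 3 / 2 * Real.log q.2 - Real.log q.1 - f q.1 := by
    funext q; rfl
  rw [this]
  have h1 : MapsTo (fun q : ℝ × ℝ => q.1) (Ioi (0 : ℝ) ×ˢ Ioi 0) {0}ᶜ :=
    fun q hq => ne_of_gt hq.1
  have h2 : MapsTo (fun q : ℝ × ℝ => q.2) (Ioi (0 : ℝ) ×ˢ Ioi 0) {0}ᶜ :=
    fun q hq => ne_of_gt hq.2
  refine ((contDiffOn_const.mul (Real.contDiffOn_log.comp contDiffOn_snd h2)).sub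
    (Real.contDiffOn_log.comp contDiffOn_fst h1)).sub (hf.comp contDiffOn_fst fun q hq => hq.1)

/-- `ϑ`-derivatives of the monatomic constitutive functions at `ϑ > 0`: `∂_ϑ e = 3/2`,
`∂_ϑ s = 3/(2ϑ)`. [folklore] -/
theorem monatomicExcess_deriv_theta (ρ : ℝ) {ϑ : ℝ} (hϑ : 0 < ϑ) :
    deriv (fun θ => (EulerEOS.monatomicExcess χ f).e ρ θ) ϑ = 3 / 2 ∧
      deriv (fun θ => (EulerEOS.monatomicExcess χ f).s ρ θ) ϑ = 3 / 2 * ϑ⁻¹ := by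
  simp only [EulerEOS.monatomicExcess]
  constructor
  · have h : HasDerivAt (fun θ : ℝ => 3 / 2 * θ) (3 / 2 * 1) ϑ := (hasDerivAt_id ϑ).const_mul _
    rw [h.deriv, mul_one]
  · have h : HasDerivAt (fun θ : ℝ => 3 / 2 * Real.log θ - Real.log ρ - f ρ) (3 / 2 * ϑ⁻¹ - 0 - 0) ϑ :=
      (((Real.hasDerivAt_log hϑ.ne').const_mul _).sub (hasDerivAt_const ϑ _)).sub
        (hasDerivAt_const ϑ _)
    rw [h.deriv, sub_zero, sub_zero]

/-- `ρ`-derivatives of the monatomic constitutive functions at `ρ > 0` (with `f`, `χ` differentiable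
there): `∂_ρ e = 0`, `∂_ρ s = -1/ρ - f'(ρ)`, `∂_ρ p = ϑ (χ ρ + ρ χ'(ρ))`. [folklore] -/
theorem monatomicExcess_deriv_rho {ρ : ℝ} (hρ : 0 < ρ) (ϑ : ℝ) (hf : DifferentiableAt ℝ f ρ)
    (hχ : DifferentiableAt ℝ χ ρ) :
    deriv (fun r => (EulerEOS.monatomicExcess χ f).e r ϑ) ρ = 0 ∧
      deriv (fun r => (EulerEOS.monatomicExcess χ f).s r ϑ) ρ = -ρ⁻¹ - deriv f ρ ∧
      deriv (fun r => (EulerEOS.monatomicExcess χ f).p r ϑ) ρ = ϑ * (χ ρ + ρ * deriv χ ρ) := by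
  simp only [EulerEOS.monatomicExcess]
  refine ⟨deriv_const ρ _, ?_, ?_⟩
  · have h : HasDerivAt (fun r : ℝ => 3 / 2 * Real.log ϑ - Real.log r - f r)
        (0 - ρ⁻¹ - deriv f ρ) ρ :=
      ((hasDerivAt_const ρ _).sub (Real.hasDerivAt_log hρ.ne')).sub hf.hasDerivAt
    simpa using h.deriv
  · have h : HasDerivAt (fun r : ℝ => r * ϑ * χ r) ((1 * ϑ) * χ ρ + ρ * ϑ * deriv χ ρ) ρ :=
      (((hasDerivAt_id ρ).mul_const ϑ)).mul hχ.hasDerivAt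
    rw [h.deriv]
    ring

/-- **Gibbs' relation for the monatomic gas with excess free energy.** If `χ, f` are `C¹` on
`(0,∞)` and satisfy the virial relation `χ ρ = 1 + ρ f'(ρ)` (which is the DEFINITION of
`hsCompressibility` from `hsExcessFreeEnergy` for the hard-sphere law), then
`EulerEOS.monatomicExcess χ f` satisfies `IsGibbs`: `ϑ∂_ϑ s = 3/2 = ∂_ϑ e` and
`ϑ∂_ρ s = -ϑ/ρ - ϑ f' = -p/ρ² = ∂_ρ e - p/ρ²`. [folklore] -/
theorem monatomicExcess_isGibbs (hχ : ContDiffOn ℝ 1 χ (Ioi 0)) (hf : ContDiffOn ℝ 1 f (Ioi 0))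
    (hvir : ∀ ρ, 0 < ρ → χ ρ = 1 + ρ * deriv f ρ) :
    (EulerEOS.monatomicExcess χ f).IsGibbs := by
  refine ⟨monatomicExcess_contDiffOn_p χ f hχ, monatomicExcess_contDiffOn_e χ f _,
    monatomicExcess_contDiffOn_s χ f hf, fun ρ ϑ hρ hϑ => ?_⟩
  have hfd : DifferentiableAt ℝ f ρ :=
    (hf.differentiableOn one_ne_zero).differentiableAt (Ioi_mem_nhds hρ)
  have hχd : DifferentiableAt ℝ χ ρ :=
    (hχ.differentiableOn one_ne_zero).differentiableAt (Ioi_mem_nhds hρ)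
  obtain ⟨he, hs⟩ := monatomicExcess_deriv_theta χ f ρ hϑ
  obtain ⟨he', hs', -⟩ := monatomicExcess_deriv_rho χ f hρ ϑ hfd hχd
  refine ⟨?_, ?_⟩
  · rw [he, hs]
    field_simp
  · rw [he', hs']
    simp only [EulerEOS.monatomicExcess, hvir ρ hρ]
    field_simp
    ring

/-- **Thermodynamic stability of the monatomic gas with excess free energy.** If `χ` is
differentiable on `(0,∞)` with `(ρχ)' = χ + ρχ' > 0`, then `∂_ρ p = ϑ(χ + ρχ') > 0` and
`∂_ϑ e = 3/2 > 0` on the open quadrant. [folklore] -/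
theorem monatomicExcess_isThermodynamicallyStable (hχ : ∀ ρ, 0 < ρ → DifferentiableAt ℝ χ ρ)
    (hmono : ∀ ρ, 0 < ρ → 0 < χ ρ + ρ * deriv χ ρ) :
    (EulerEOS.monatomicExcess χ f).IsThermodynamicallyStable := by
  intro ρ ϑ hρ hϑ
  obtain ⟨he, -⟩ := monatomicExcess_deriv_theta χ f ρ hϑ
  have hp : deriv (fun r => (EulerEOS.monatomicExcess χ f).p r ϑ) ρ = ϑ * (χ ρ + ρ * deriv χ ρ) := by
    simp only [EulerEOS.monatomicExcess]
    have h : HasDerivAt (fun r : ℝ => r * ϑ * χ r) ((1 * ϑ) * χ ρ + ρ * ϑ * deriv χ ρ) ρ :=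
      (((hasDerivAt_id ρ).mul_const ϑ)).mul (hχ ρ hρ).hasDerivAt
    rw [h.deriv]
    ring
  rw [hp, he]
  exact ⟨mul_pos hϑ (hmono ρ hρ), by norm_num⟩

/-- **Pressure growth (BF (3.1)) for the monatomic gas with excess free energy.** If `|χ| ≤ B` on
`(0,∞)` then `|p| = ρϑ|χ| ≤ (2B/3) · ρ e ≤ c (1 + ρ + ρ|s| + ρ e)` with `c = 2B/3`. [folklore] -/
theorem monatomicExcess_growth {B : ℝ} (hB : ∀ ρ, 0 < ρ → |χ ρ| ≤ B) :
    ∃ c : ℝ, ∀ ρ ϑ : ℝ, 0 < ρ → 0 < ϑ →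
      |(EulerEOS.monatomicExcess χ f).p ρ ϑ| ≤
        c * (1 + ρ + ρ * |(EulerEOS.monatomicExcess χ f).s ρ ϑ| +
          ρ * (EulerEOS.monatomicExcess χ f).e ρ ϑ) := by
  have hB0 : 0 ≤ B := (abs_nonneg _).trans (hB 1 one_pos)
  refine ⟨2 * B / 3, fun ρ ϑ hρ hϑ => ?_⟩
  simp only [EulerEOS.monatomicExcess]
  rw [abs_mul, abs_mul, abs_of_pos hρ, abs_of_pos hϑ]
  have h1 : ρ * ϑ * |χ ρ| ≤ ρ * ϑ * B :=
    mul_le_mul_of_nonneg_left (hB ρ hρ) (mul_pos hρ hϑ).le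
  have h2 : 0 ≤ 1 + ρ + ρ * |3 / 2 * Real.log ϑ - Real.log ρ - f ρ| := by positivity
  calc ρ * ϑ * |χ ρ| ≤ ρ * ϑ * B := h1
    _ = 2 * B / 3 * (ρ * (3 / 2 * ϑ)) := by ring
    _ ≤ 2 * B / 3 * (1 + ρ + ρ * |3 / 2 * Real.log ϑ - Real.log ρ - f ρ| + ρ * (3 / 2 * ϑ)) := by
      refine mul_le_mul_of_nonneg_left ?_ (by positivity)
      linarith

/-- **All equation-of-state hypotheses of `brezinaFeireisl2018_thm_3_3` at once** for
`EulerEOS.monatomicExcess χ f`: if `χ, f ∈ C²(0,∞)`, `χ ρ = 1 + ρ f'(ρ)`, `(ρχ)' > 0` and `|χ| ≤ B`,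
then Gibbs, stability, `C²` regularity of `p, e, s` on the open quadrant, `e > 0`, the temperature
inversion and the growth bound (3.1) hold — so the weak(mv)–strong uniqueness theorem applies to
classical solutions and dissipative measure-valued solutions for this law. [folklore] -/
theorem monatomicExcess_bf_hypotheses (hχ : ContDiffOn ℝ 2 χ (Ioi 0)) (hf : ContDiffOn ℝ 2 f (Ioi 0))
    (hvir : ∀ ρ, 0 < ρ → χ ρ = 1 + ρ * deriv f ρ)
    (hmono : ∀ ρ, 0 < ρ → 0 < χ ρ + ρ * deriv χ ρ) {B : ℝ} (hB : ∀ ρ, 0 < ρ → |χ ρ| ≤ B) :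
    (EulerEOS.monatomicExcess χ f).IsGibbs ∧
    (EulerEOS.monatomicExcess χ f).IsThermodynamicallyStable ∧
    ContDiffOn ℝ 2 (Function.uncurry (EulerEOS.monatomicExcess χ f).p) (Ioi 0 ×ˢ Ioi 0) ∧
    ContDiffOn ℝ 2 (Function.uncurry (EulerEOS.monatomicExcess χ f).e) (Ioi 0 ×ˢ Ioi 0) ∧
    ContDiffOn ℝ 2 (Function.uncurry (EulerEOS.monatomicExcess χ f).s) (Ioi 0 ×ˢ Ioi 0) ∧
    (∀ r θ : ℝ, 0 < r → 0 < θ → 0 < (EulerEOS.monatomicExcess χ f).e r θ) ∧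
    (∀ r E : ℝ, 0 < r → 0 < E → 0 < (EulerEOS.monatomicExcess χ f).temperature r E ∧
      r * (EulerEOS.monatomicExcess χ f).e r ((EulerEOS.monatomicExcess χ f).temperature r E) = E) ∧
    (∃ c : ℝ, ∀ r θ : ℝ, 0 < r → 0 < θ →
      |(EulerEOS.monatomicExcess χ f).p r θ| ≤
        c * (1 + r + r * |(EulerEOS.monatomicExcess χ f).s r θ| +
          r * (EulerEOS.monatomicExcess χ f).e r θ)) := by
  have hχ1 : ContDiffOn ℝ 1 χ (Ioi 0) := hχ.of_le (by norm_num)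
  have hf1 : ContDiffOn ℝ 1 f (Ioi 0) := hf.of_le (by norm_num)
  have hχd : ∀ ρ, 0 < ρ → DifferentiableAt ℝ χ ρ := fun ρ hρ =>
    (hχ1.differentiableOn one_ne_zero).differentiableAt (Ioi_mem_nhds hρ)
  exact ⟨monatomicExcess_isGibbs χ f hχ1 hf1 hvir,
    monatomicExcess_isThermodynamicallyStable χ f hχd hmono,
    monatomicExcess_contDiffOn_p χ f hχ, monatomicExcess_contDiffOn_e χ f _,
    monatomicExcess_contDiffOn_s χ f hf, fun r θ _ hθ => monatomicExcess_e_pos χ f r hθ,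
    fun r E hr hE => monatomicExcess_temperature χ f hr hE, monatomicExcess_growth χ f hB⟩

end Summit.AtomisticToContinuum.HydrodynamicLimit.Theorems
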